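import Mathlib
import HarnessLib
import Literature.Analysis.Asymptotics.PoincareRatioTheorem

/-!
# Zeta5Search / Elimination / StepEliminant — the step (Casoratian) eliminant has NO cancellation

Cell `pub-zeta5`, construction class `elim` (families/elim/FAMILY.md, proposition **P2**), staged by the
fam-elim g2 seat for filing under `Summits/KontsevichZagierPeriods/Zeta5Search/Elimination/StepEliminant.lean`.
HONEST FRAMING: systematic search; no irrationality claim unless certified.
(Filed for `fam-elim` by P2; one docstring added for the gate's lint, statements and proofs byte-identical.) Pure real analysis; nothing
here mentions zeta values.

Setting. A three-term family of linear forms `r n = Q n • ξ₁ + w n • ξ₂ − P n` (in the application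
`ξ₁ = ζ(5)`, `ξ₂ = ζ(3)`, `w = P̂`) is turned into two-term forms in `ξ₁` alone by ELIMINATING `ξ₂` between
consecutive members: the *step eliminant*
`stepElim w r n = w (n+1) * r n − w n * r (n+1) = (w (n+1) Q n − w n Q (n+1)) ξ₁ − (w (n+1) P n − w n P (n+1))`
(a Casoratian-type `2 × 2` minor; Zudilin's "one of the numbers …" determinant step, Fischler–Zudilin's
refined criterion `Literature.…FischlerZudilin2010.theorem2` read as a product rule — FAMILY.md P3).

What is PROVED (elementary, [folklore]):
* `stepElim_div` — the identity `stepElim w r n / (w n * r n) = w (n+1)/w n − r (n+1)/r n`;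
* `stepElim_bracket` — CERTIFICATE FORM: a ratio bracket `0 ≤ L₁ ≤ w (n+1)/w n ≤ L₂` for the eliminated
  coefficient and a decay bracket `|r (n+1)/r n| ≤ λ₊` for the form give the two-sided bound
  `(L₁ − λ₊)|w n r n| ≤ |stepElim w r n| ≤ (L₂ + λ₊)|w n r n|` — with `λ₊ < L₁` the minor is comparable to the
  product `w n * r n`: NO cancellation;
* `tendsto_stepElim_div` — LIMIT FORM: `w (n+1)/w n → Λ` and `r (n+1)/r n → λ` give
  `stepElim w r n / (w n r n) → Λ − λ`; `stepElim_eventually_two_sided` — hence for `Λ ≠ λ` eventually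
  `(|Λ − λ|/2)|w n r n| ≤ |stepElim w r n| ≤ 2|Λ − λ| |w n r n|` and in particular `stepElim w r n ≠ 0`;
* `tendsto_log_abs_stepElim_div` — RATE FORM: `log |stepElim w r n| / n → log |Λ| + log |λ|`
  (uses the tree's Poincaré Lemma 7.14 `PoincareRecurrence.tendsto_log_abs_div_of_tendsto_ratio`).

Reading for the cell (FAMILY.md P2, now a theorem given the two ratio limits): with `|w n| = e^{b n + o(n)}`
(`Λ = e^{b}`, the dominant root — supplied for Apéry/Zudilin-type recursions by
`PoincareRecurrence.tendsto_ratio_of_recurrence₃` from a certified ratio bracket) and `|r n| = e^{−c n + o(n)}`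
(`λ = e^{−c}`, the proved asymptotics of the forms), the step eliminant has rate EXACTLY `b − c`: eliminating
`ξ₂` inside one family costs the full growth `b` of the eliminated coefficient and the tie of rates between
consecutive members produces no saving. Denominators multiply (product rule, fam-denom
`Zeta5Search/Denom/ElimProductRule.lean`), so the margin of the step pair is the Fischler–Zudilin exponent of the
family plus whatever cancellation of the minor is separately PROVED — and nothing else (FAMILY.md P2/P3).
-/

noncomputable section

open Filter
open scoped Topology

namespace Summit.KontsevichZagierPeriods.Zeta5Search.Elimination

/-- The step (Casoratian-type) eliminant of two sequences: the `2 × 2` minor of consecutive members,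
`w (n+1) * r n − w n * r (n+1)`. [folklore] -/
def stepElim (w r : ℕ → ℝ) (n : ℕ) : ℝ := w (n + 1) * r n - w n * r (n + 1)

/-- Unfolding lemma for `stepElim`. -/
theorem stepElim_def (w r : ℕ → ℝ) (n : ℕ) :
    stepElim w r n = w (n + 1) * r n - w n * r (n + 1) := rfl

/-- The eliminant is antisymmetric in its two arguments. [folklore] -/
theorem stepElim_swap (w r : ℕ → ℝ) (n : ℕ) : stepElim r w n = -stepElim w r n := by
  unfold stepElim; ring

/-- Normalised form: `stepElim w r n / (w n * r n) = w (n+1)/w n − r (n+1)/r n`. [folklore] -/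
theorem stepElim_div (w r : ℕ → ℝ) {n : ℕ} (hw : w n ≠ 0) (hr : r n ≠ 0) :
    stepElim w r n / (w n * r n) = w (n + 1) / w n - r (n + 1) / r n := by
  unfold stepElim
  field_simp

/-- Product form: `stepElim w r n = (w n * r n) * (w (n+1)/w n − r (n+1)/r n)`. [folklore] -/
theorem stepElim_eq_mul (w r : ℕ → ℝ) {n : ℕ} (hw : w n ≠ 0) (hr : r n ≠ 0) :
    stepElim w r n = (w n * r n) * (w (n + 1) / w n - r (n + 1) / r n) := by
  rw [← stepElim_div w r hw hr]
  field_simp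

/-- CERTIFICATE FORM (ratio brackets, one index). If `0 ≤ L₁ ≤ w (n+1)/w n ≤ L₂` and `|r (n+1)/r n| ≤ λ₊`
then `(L₁ − λ₊)|w n r n| ≤ |stepElim w r n| ≤ (L₂ + λ₊)|w n r n|`. With `λ₊ < L₁` (the eliminated
coefficient grows strictly faster in ratio than the form) the lower bound is positive: no cancellation.
[folklore] -/
theorem stepElim_bracket {w r : ℕ → ℝ} {L₁ L₂ lamP : ℝ} {n : ℕ} (hw : w n ≠ 0) (hr : r n ≠ 0)
    (hL₁ : 0 ≤ L₁) (h₁ : L₁ ≤ w (n + 1) / w n) (h₂ : w (n + 1) / w n ≤ L₂)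
    (h₃ : |r (n + 1) / r n| ≤ lamP) :
    (L₁ - lamP) * |w n * r n| ≤ |stepElim w r n| ∧
      |stepElim w r n| ≤ (L₂ + lamP) * |w n * r n| := by
  have hprod : 0 ≤ |w n * r n| := abs_nonneg _
  set x := w (n + 1) / w n with hx
  set y := r (n + 1) / r n with hy
  have habsx : |x| = x := abs_of_nonneg (le_trans hL₁ h₁)
  have hE : |stepElim w r n| = |w n * r n| * |x - y| := by
    rw [stepElim_eq_mul w r hw hr, abs_mul]
  have hlow : L₁ - lamP ≤ |x - y| := by
    have h := abs_sub_abs_le_abs_sub x y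
    rw [habsx] at h
    linarith
  have hup : |x - y| ≤ L₂ + lamP := by
    have h := abs_sub x y
    rw [habsx] at h
    linarith
  constructor
  · rw [hE, mul_comm]
    exact mul_le_mul_of_nonneg_left hlow hprod
  · rw [hE, mul_comm]
    exact mul_le_mul_of_nonneg_right hup hprod

/-- CERTIFICATE FORM on a tail: brackets valid for all `n ≥ N` give the two-sided comparison for all
`n ≥ N`. [folklore] -/
theorem stepElim_bracket_tail {w r : ℕ → ℝ} {L₁ L₂ lamP : ℝ} (N : ℕ)
    (hw : ∀ n, N ≤ n → w n ≠ 0) (hr : ∀ n, N ≤ n → r n ≠ 0) (hL₁ : 0 ≤ L₁)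
    (h₁ : ∀ n, N ≤ n → L₁ ≤ w (n + 1) / w n) (h₂ : ∀ n, N ≤ n → w (n + 1) / w n ≤ L₂)
    (h₃ : ∀ n, N ≤ n → |r (n + 1) / r n| ≤ lamP) :
    ∀ n, N ≤ n → (L₁ - lamP) * |w n * r n| ≤ |stepElim w r n| ∧
      |stepElim w r n| ≤ (L₂ + lamP) * |w n * r n| :=
  fun n hn => stepElim_bracket (hw n hn) (hr n hn) hL₁ (h₁ n hn) (h₂ n hn) (h₃ n hn)

/-- LIMIT FORM. If `w (n+1)/w n → Λ` and `r (n+1)/r n → λ` (both sequences eventually non-zero) then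
`stepElim w r n / (w n * r n) → Λ − λ`. [folklore] -/
theorem tendsto_stepElim_div (w r : ℕ → ℝ) {Lam lam : ℝ} (N : ℕ)
    (hw : ∀ n, N ≤ n → w n ≠ 0) (hr : ∀ n, N ≤ n → r n ≠ 0)
    (hW : Tendsto (fun n => w (n + 1) / w n) atTop (𝓝 Lam))
    (hR : Tendsto (fun n => r (n + 1) / r n) atTop (𝓝 lam)) :
    Tendsto (fun n => stepElim w r n / (w n * r n)) atTop (𝓝 (Lam - lam)) := by
  have hev : ∀ᶠ n in atTop, w (n + 1) / w n - r (n + 1) / r n = stepElim w r n / (w n * r n) := by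
    filter_upwards [eventually_ge_atTop N] with n hn
    rw [stepElim_div w r (hw n hn) (hr n hn)]
  exact (hW.sub hR).congr' hev

/-- LIMIT FORM, two-sided consequence. If moreover `Λ ≠ λ` then eventually
`(|Λ − λ|/2)|w n r n| ≤ |stepElim w r n| ≤ 2|Λ − λ| |w n r n|`: the step eliminant is comparable to the
product of its entries — NO cancellation. [folklore] -/
theorem stepElim_eventually_two_sided (w r : ℕ → ℝ) {Lam lam : ℝ} (N : ℕ)
    (hw : ∀ n, N ≤ n → w n ≠ 0) (hr : ∀ n, N ≤ n → r n ≠ 0)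
    (hW : Tendsto (fun n => w (n + 1) / w n) atTop (𝓝 Lam))
    (hR : Tendsto (fun n => r (n + 1) / r n) atTop (𝓝 lam)) (hne : Lam ≠ lam) :
    ∀ᶠ n in atTop, |Lam - lam| / 2 * |w n * r n| ≤ |stepElim w r n| ∧
      |stepElim w r n| ≤ 2 * |Lam - lam| * |w n * r n| := by
  have hgap : 0 < |Lam - lam| / 2 := by
    have : 0 < |Lam - lam| := abs_pos.2 (sub_ne_zero.2 hne)
    linarith
  have hlim := tendsto_stepElim_div w r N hw hr hW hR
  have hclose : ∀ᶠ n in atTop, |stepElim w r n / (w n * r n) - (Lam - lam)| < |Lam - lam| / 2 := by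
    have h := (Metric.tendsto_atTop.1 hlim) _ hgap
    obtain ⟨M, hM⟩ := h
    filter_upwards [eventually_ge_atTop M] with n hn
    have := hM n hn
    rwa [Real.dist_eq] at this
  filter_upwards [hclose, eventually_ge_atTop N] with n hn hNn
  have hwn := hw n hNn
  have hrn := hr n hNn
  have hp : 0 < |w n * r n| := abs_pos.2 (mul_ne_zero hwn hrn)
  have hq : |stepElim w r n| = |stepElim w r n / (w n * r n)| * |w n * r n| := by
    rw [abs_div, div_mul_cancel₀ _ (ne_of_gt hp)]
  -- bounds on the normalised minor
  have h1 : |Lam - lam| / 2 ≤ |stepElim w r n / (w n * r n)| := by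
    have := abs_sub_abs_le_abs_sub (Lam - lam) (stepElim w r n / (w n * r n))
    rw [abs_sub_comm] at hn
    linarith
  have h2 : |stepElim w r n / (w n * r n)| ≤ 2 * |Lam - lam| := by
    have := abs_sub_abs_le_abs_sub (stepElim w r n / (w n * r n)) (Lam - lam)
    have h0 : 0 ≤ |Lam - lam| := abs_nonneg _
    linarith
  constructor
  · rw [hq]; exact mul_le_mul_of_nonneg_right h1 (le_of_lt hp)
  · rw [hq]; exact mul_le_mul_of_nonneg_right h2 (le_of_lt hp)

/-- In particular the step eliminant is eventually non-zero when `Λ ≠ λ`. [folklore] -/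
theorem stepElim_eventually_ne_zero (w r : ℕ → ℝ) {Lam lam : ℝ} (N : ℕ)
    (hw : ∀ n, N ≤ n → w n ≠ 0) (hr : ∀ n, N ≤ n → r n ≠ 0)
    (hW : Tendsto (fun n => w (n + 1) / w n) atTop (𝓝 Lam))
    (hR : Tendsto (fun n => r (n + 1) / r n) atTop (𝓝 lam)) (hne : Lam ≠ lam) :
    ∀ᶠ n in atTop, stepElim w r n ≠ 0 := by
  have hgap : 0 < |Lam - lam| / 2 := by
    have : 0 < |Lam - lam| := abs_pos.2 (sub_ne_zero.2 hne)
    linarith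
  filter_upwards [stepElim_eventually_two_sided w r N hw hr hW hR hne, eventually_ge_atTop N]
    with n hn hNn
  have hp : 0 < |w n * r n| := abs_pos.2 (mul_ne_zero (hw n hNn) (hr n hNn))
  have : 0 < |stepElim w r n| := lt_of_lt_of_le (mul_pos hgap hp) hn.1
  exact abs_pos.1 this

/-- RATE FORM. If `w (n+1)/w n → Λ ≠ 0`, `r (n+1)/r n → λ ≠ 0` and `Λ ≠ λ` then
`log |stepElim w r n| / n → log |Λ| + log |λ|`: the exponential rate of the step eliminant is the SUM of
the rates of its entries (growth `b = log Λ` of the eliminated coefficient plus rate `−c = log λ` of the form),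
with no saving from the tie of rates between consecutive members. [folklore; Poincaré Lemma 7.14 via
`Literature.Analysis.Asymptotics.PoincareRecurrence.tendsto_log_abs_div_of_tendsto_ratio`] -/
theorem tendsto_log_abs_stepElim_div (w r : ℕ → ℝ) {Lam lam : ℝ} (N : ℕ)
    (hw : ∀ n, N ≤ n → w n ≠ 0) (hr : ∀ n, N ≤ n → r n ≠ 0)
    (hW : Tendsto (fun n => w (n + 1) / w n) atTop (𝓝 Lam))
    (hR : Tendsto (fun n => r (n + 1) / r n) atTop (𝓝 lam))
    (hLam : Lam ≠ 0) (hlam : lam ≠ 0) (hne : Lam ≠ lam) :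
    Tendsto (fun n => Real.log |stepElim w r n| / n) atTop
      (𝓝 (Real.log |Lam| + Real.log |lam|)) := by
  -- rates of the entries (Poincaré, Lemma 7.14)
  have hw' := Literature.Analysis.Asymptotics.PoincareRecurrence.tendsto_log_abs_div_of_tendsto_ratio
    w N hw hLam hW
  have hr' := Literature.Analysis.Asymptotics.PoincareRecurrence.tendsto_log_abs_div_of_tendsto_ratio
    r N hr hlam hR
  -- the normalised minor has a finite non-zero limit, so its log is bounded and `log(…)/n → 0`
  have hq := tendsto_stepElim_div w r N hw hr hW hR
  have hq' : Tendsto (fun n => Real.log |stepElim w r n / (w n * r n)|) atTop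
      (𝓝 (Real.log |Lam - lam|)) :=
    (hq.abs).log (abs_ne_zero.2 (sub_ne_zero.2 hne))
  have hq0 : Tendsto (fun n => Real.log |stepElim w r n / (w n * r n)| / n) atTop (𝓝 0) := by
    have hinv : Tendsto (fun n : ℕ => (n : ℝ)⁻¹) atTop (𝓝 0) := tendsto_inv_atTop_nhds_zero_nat
    have h := hq'.mul hinv
    rw [mul_zero] at h
    simpa only [div_eq_mul_inv] using h
  -- eventually `log|E n| = log|E n/(w n r n)| + log|w n| + log|r n|`
  have hev : ∀ᶠ n in atTop, Real.log |stepElim w r n / (w n * r n)| / n + Real.log |w n| / n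
      + Real.log |r n| / n = Real.log |stepElim w r n| / n := by
    filter_upwards [stepElim_eventually_ne_zero w r N hw hr hW hR hne, eventually_ge_atTop N]
      with n hEn hNn
    have hwn := hw n hNn
    have hrn := hr n hNn
    have hsplit : Real.log |stepElim w r n| = Real.log |stepElim w r n / (w n * r n)|
        + Real.log |w n| + Real.log |r n| := by
      rw [abs_div, abs_mul, Real.log_div (abs_ne_zero.2 hEn)
        (mul_ne_zero (abs_ne_zero.2 hwn) (abs_ne_zero.2 hrn)),
        Real.log_mul (abs_ne_zero.2 hwn) (abs_ne_zero.2 hrn)]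
      ring
    rw [hsplit]
    ring
  have hsum := (hq0.add hw').add hr'
  simp only [zero_add] at hsum
  exact hsum.congr' hev

end Summit.KontsevichZagierPeriods.Zeta5Search.Elimination

end
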